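/-
Origin: expansion seat `planner-pub-hodgecm-pv11-g4-0`, handover #2 2026-08-18T06:55:56Z (`HOME/pub-hodgecm-pv11-g4/lean/Pv11g4/NormOneRelTorusExtras.lean`, md5 f4bae21d, 168 lines);
landed by the gen-7 packager in gate run 25 as `HodgeCM/PerL34/NormOneRelTorusExtras.lean` (import ^import Pv[0-9]+g[0-9]+\.→import HodgeCM.PerL34. ×1).
-/
/-
Origin: expansion seat `planner-pub-hodgecm-pv11-g4-0` (unit `pub-hodgecm-pv11-g4`, DAG-NODE PROVER #11 gen 4), HodgeCM publication
cell, 2026-08-18.  WIP module `Pv11g4.NormOneRelTorusExtras`; intended landing `HodgeCM/PerL34/NormOneRelTorusExtras.lean`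
(one import rewrite: `Pv11g4.NormOneRelTorus` ↦ `HodgeCM.PerL34.NormOneRelTorus`).
-/
import Summits.HodgeConjecture.HodgeCM.PerL34.NormOneRelTorus_2

/-!
# `U(W_j)(L₀) ≅ L^1` as a group isomorphism, and the mass-one measure on `[U(W_j)]`

Two complements to `NormOneRelTorus`:

* `NumberField.normOneUnits K L : Subgroup Lˣ` — `L^1 := ker (N_{L/K} : L^× → K^×)` (Mathlib's `Algebra.norm`), and for
  `L/K` Galois the **group isomorphism** `NumberField.relNormOneRatEquiv K L : normOneUnits K L ≃* relNormOneRat K L`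
  (`ℓ ↦ (ℓ)`): the rational points of the constructed torus `U(1)_{L/K}` ARE the field-theoretic `L^1` of PerL l. 264,
  not merely in bijection by a membership lemma;
* `NumberField.probHaarRelNormOneQuot K L` — the Haar measure on `[U(1)_{L/K}] = L^1 \ U(1)(𝔸_K)` normalised to total mass
  one (`IsProbabilityMeasure`), still open-positive and (left/right) invariant: the `du` with `vol [U(W_j)] = 1`, and the
  corresponding datum `NumberField.relNormOneTorusDatumProb` / `unitaryLineTorusDatumProb`.

Everything is proved; inputs = `NormOneRelTorus` + Mathlib (`MulEquiv.ofBijective`, `Measure.haarMeasure ⊤`,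
`haarMeasure_self`).  No PerL / QW8 / 2001-programme statement is used.
-/

set_option autoImplicit false

noncomputable section

open Topology Set Function MeasureTheory
open scoped NNReal

namespace NumberField

open IsDedekindDomain

section RationalPoints

variable (K L : Type) [Field K] [Field L] [Algebra K L]

/-- **`L^1 := ker (N_{L/K} : L^× → K^×)`**, the norm-one elements of `L^×` (`U(W_j)(L₀)` for a hermitian line). -/
def normOneUnits : Subgroup Lˣ := (Units.map (Algebra.norm K : L →* K)).ker

/-- (Ported verbatim from the HodgeCMPerL package; no docstring in the source.) -/
theorem mem_normOneUnits_iff (ℓ : Lˣ) : ℓ ∈ normOneUnits K L ↔ Algebra.norm K (ℓ : L) = 1 := by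
  rw [normOneUnits, MonoidHom.mem_ker, ← Units.val_eq_one, Units.coe_map]

variable [NumberField L]

/-- The diagonal embedding `L^× → 𝔸_L^×`, `ℓ ↦ (ℓ)`. -/
def principalIdeleMap : Lˣ →* ideleGroup L :=
  Units.map (algebraMap L (AdeleRing (𝓞 L) L) : L →* AdeleRing (𝓞 L) L)

/-- (Ported verbatim from the HodgeCMPerL package; no docstring in the source.) -/
theorem principalIdeleMap_mem (ℓ : Lˣ) : principalIdeleMap L ℓ ∈ principalIdeles L := ⟨ℓ, rfl⟩

/-- (Ported verbatim from the HodgeCMPerL package; no docstring in the source.) -/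
theorem principalIdeleMap_injective : Function.Injective (principalIdeleMap L) := by
  intro a b h
  have h' := congrArg (fun u : ideleGroup L => (u : AdeleRing (𝓞 L) L)) h
  simp only [principalIdeleMap, Units.coe_map, MonoidHom.coe_coe] at h'
  exact Units.ext (AdeleRing.algebraMap_injective (𝓞 L) L h')

/-- (Ported verbatim from the HodgeCMPerL package; no docstring in the source.) -/
theorem range_principalIdeleMap : (principalIdeleMap L).range = principalIdeles L := rfl

variable [FiniteDimensional K L] [IsGalois K L]

/-- `ℓ ↦ (ℓ)` as a homomorphism `L^1 → U(1)_{L/K}(K) ≤ U(1)_{L/K}(𝔸_K)`. -/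
def toRelNormOneRat : normOneUnits K L →* relNormOneRat K L where
  toFun ℓ :=
    ⟨⟨principalIdeleMap L ℓ, (principal_mem_relNormOneIdeles_iff K L (ℓ : Lˣ)).mpr ((mem_normOneUnits_iff K L _).mp ℓ.2)⟩,
      (mem_relNormOneRat_iff K L _).mpr (principalIdeleMap_mem L ℓ)⟩
  map_one' := Subtype.ext (Subtype.ext (by simp only [OneMemClass.coe_one, map_one]))
  map_mul' a b := Subtype.ext (Subtype.ext (by simp only [Subgroup.coe_mul, map_mul]))

/-- (Ported verbatim from the HodgeCMPerL package; no docstring in the source.) -/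
@[simp] theorem coe_coe_toRelNormOneRat (ℓ : normOneUnits K L) :
    (((toRelNormOneRat K L ℓ : relNormOneRat K L) : relNormOneIdeles K L) : ideleGroup L) = principalIdeleMap L ℓ := rfl

/-- (Ported verbatim from the HodgeCMPerL package; no docstring in the source.) -/
theorem toRelNormOneRat_bijective : Function.Bijective (toRelNormOneRat K L) := by
  refine ⟨fun a b h => ?_, fun a => ?_⟩
  · have h' := congrArg (fun x : relNormOneRat K L => ((x : relNormOneIdeles K L) : ideleGroup L)) h
    simp only [coe_coe_toRelNormOneRat] at h'
    exact Subtype.ext (principalIdeleMap_injective L h')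
  · obtain ⟨ℓ, hℓ⟩ := (mem_relNormOneRat_iff K L _).mp a.2
    have hmem : principalIdeleMap L ℓ ∈ relNormOneIdeles K L := by
      rw [show principalIdeleMap L ℓ = ((a : relNormOneIdeles K L) : ideleGroup L) from hℓ]
      exact (a : relNormOneIdeles K L).2
    refine ⟨⟨ℓ, (mem_normOneUnits_iff K L ℓ).mpr ((principal_mem_relNormOneIdeles_iff K L ℓ).mp hmem)⟩, ?_⟩
    exact Subtype.ext (Subtype.ext hℓ)

/-- **`U(W_j)(L₀) ≅ L^1`**: for `L/K` Galois, the rational points of the torus `U(1)_{L/K}` (the principal ideles of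
relative norm one) are isomorphic, by `ℓ ↦ (ℓ)`, to `ker (N_{L/K} : L^× → K^×)`. -/
def relNormOneRatEquiv : normOneUnits K L ≃* relNormOneRat K L :=
  MulEquiv.ofBijective (toRelNormOneRat K L) (toRelNormOneRat_bijective K L)

/-- (Ported verbatim from the HodgeCMPerL package; no docstring in the source.) -/
@[simp] theorem coe_coe_relNormOneRatEquiv (ℓ : normOneUnits K L) :
    (((relNormOneRatEquiv K L ℓ : relNormOneRat K L) : relNormOneIdeles K L) : ideleGroup L) = principalIdeleMap L ℓ := rfl

end RationalPoints

/-! ## The mass-one invariant measure on `[U(1)_{L/K}]` -/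

section Probability

variable (K L : Type) [Field K] [Field L] [NumberField L] [Algebra K L] [FiniteDimensional K L]

/-- (Ported verbatim from the HodgeCMPerL package; no docstring in the source.) -/
instance nonempty_relNormOneQuot : Nonempty (relNormOneIdeles K L ⧸ relNormOneRat K L) := ⟨1⟩

/-- The Haar measure on the compact group `[U(1)_{L/K}]` normalised by `vol [U(1)_{L/K}] = 1`. -/
def probHaarRelNormOneQuot : Measure (relNormOneIdeles K L ⧸ relNormOneRat K L) := Measure.haarMeasure ⊤

/-- (Ported verbatim from the HodgeCMPerL package; no docstring in the source.) -/
instance isHaarMeasure_probHaarRelNormOneQuot : (probHaarRelNormOneQuot K L).IsHaarMeasure := by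
  unfold probHaarRelNormOneQuot; infer_instance

/-- (Ported verbatim from the HodgeCMPerL package; no docstring in the source.) -/
instance isProbabilityMeasure_probHaarRelNormOneQuot : IsProbabilityMeasure (probHaarRelNormOneQuot K L) := by
  refine ⟨?_⟩
  have h := (Measure.haarMeasure_self (G := relNormOneIdeles K L ⧸ relNormOneRat K L) (K₀ := ⊤))
  rwa [TopologicalSpace.PositiveCompacts.coe_top] at h

/-- (Ported verbatim from the HodgeCMPerL package; no docstring in the source.) -/
instance isOpenPosMeasure_probHaarRelNormOneQuot : (probHaarRelNormOneQuot K L).IsOpenPosMeasure := by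
  unfold probHaarRelNormOneQuot; infer_instance

/-- (Ported verbatim from the HodgeCMPerL package; no docstring in the source.) -/
instance isMulLeftInvariant_probHaarRelNormOneQuot : (probHaarRelNormOneQuot K L).IsMulLeftInvariant := by
  unfold probHaarRelNormOneQuot; infer_instance

/-- (Ported verbatim from the HodgeCMPerL package; no docstring in the source.) -/
theorem map_mul_right_probHaarRelNormOneQuot (g : relNormOneIdeles K L ⧸ relNormOneRat K L) :
    Measure.map (· * g) (probHaarRelNormOneQuot K L) = probHaarRelNormOneQuot K L := by
  have h : (fun x : relNormOneIdeles K L ⧸ relNormOneRat K L => x * g) = fun x => g * x :=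
    funext fun x => mul_comm x g
  rw [h]
  exact map_mul_left_eq_self _ g

/-- (Ported verbatim from the HodgeCMPerL package; no docstring in the source.) -/
instance isMulRightInvariant_probHaarRelNormOneQuot : (probHaarRelNormOneQuot K L).IsMulRightInvariant :=
  ⟨map_mul_right_probHaarRelNormOneQuot K L⟩

/-- (Ported verbatim from the HodgeCMPerL package; no docstring in the source.) -/
theorem probHaarRelNormOneQuot_univ : probHaarRelNormOneQuot K L Set.univ = 1 := measure_univ

/-- The torus datum of `NormOneRelTorus` with the MASS-ONE measure. -/
def relNormOneTorusDatumProb : AutomorphicTorusDatum where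
  A := relNormOneIdeles K L
  rat := relNormOneRat K L
  ν := probHaarRelNormOneQuot K L

/-- (Ported verbatim from the HodgeCMPerL package; no docstring in the source.) -/
theorem relNormOneTorusDatumProb_mass_one : (relNormOneTorusDatumProb K L).ν Set.univ = 1 :=
  probHaarRelNormOneQuot_univ K L

end Probability

section CM

variable (L : Type) [Field L] [NumberField L] [IsCMField L]

/-- `[U(W_j)]` for a CM field with `vol = 1`. -/
def unitaryLineTorusDatumProb : AutomorphicTorusDatum := relNormOneTorusDatumProb (maximalRealSubfield L) L

/-- For a CM field: `ℓ ∈ L^1 ↔ ℓ · ℓ̄ = 1`. -/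
theorem mem_normOneUnits_iff_mul_conj (ℓ : Lˣ) :
    ℓ ∈ normOneUnits (maximalRealSubfield L) L ↔ (ℓ : L) * IsCMField.complexConj L (ℓ : L) = 1 := by
  classical
  rw [mem_normOneUnits_iff, ← (algebraMap (maximalRealSubfield L) L).injective.eq_iff, map_one,
    Algebra.norm_eq_prod_automorphisms, univ_eq_pair_complexConj,
    Finset.prod_pair (IsCMField.complexConj_ne_one L).symm, AlgEquiv.one_apply]

/-- **`U(W_j)(L₀) ≅ {ℓ ∈ L^× : ℓ ℓ̄ = 1}`** for a CM field `L` (`L₀ = L⁺`). -/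
def unitaryLineRatEquiv : normOneUnits (maximalRealSubfield L) L ≃* relNormOneRat (maximalRealSubfield L) L :=
  relNormOneRatEquiv (maximalRealSubfield L) L

end CM

end NumberField

end
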